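import Summits.BirchSwinnertonDyer.BirchSwinnertonDyer.Theorems.ClassRecordThreeEulerHalvesAtThreeCartanCoverInertHecke
import Summits.BirchSwinnertonDyer.BirchSwinnertonDyer.Theorems.ClassRecordThreeCartanSupplyUnipotentRigidity
import Summits.BirchSwinnertonDyer.BirchSwinnertonDyer.Theorems.ClassRecordThreeEulerHalvesAtThreeCartanTorusCubeCutCyclic
import HarnessLib

/-!
# Borel bookkeeping in `GL₂(𝔽_q)`, the trace on a line ∕ a plane, and THE BOREL LINE of a Borel eigenvector — borelghost §J∕§L helpers and §R.1–§R.3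

Lift-only port (cell bsd-stepL, SUMMON key `ghostlift`, director-bsd (837) «(κ2) GHOSTLIFT: GO NOW» 2026-08-31; lift by tam3-p1 g43) of the nine node-local `V`-free helpers of §J.1 ∕ §L.1 (source lines 86–110: `weylP_mul_weylP`, `diagU_lower`, `upperUnip_lower`, `bruhat_of_ne`; 537–541 `borel_mul`; 558–615 `eta10_ne_zero`, `exists_torus_mul_borel`; 616–624 `scalar_comm`; 641–653 `sum_mul_right_eq`) and §R.1–§R.3 (lines 2209–2379, `section BorelGhost`) of the crux-ideate workfile
`Summits/BirchSwinnertonDyer/BirchSwinnertonDyer/Cruxes/CartanOnePlaceDegreeLawAtThree/Lines/borelghost.lean` (lineage `cruxidea-stmt-BirchSwinnertonDyer-24801-1`, generation 30, commit db8906745aa4, sha256-16 4139cfefd1941dbf, 2747 l.; farm rc 0, sorries 5 = its §4 stubs, none of which is lifted; referee FULL BATTERY PASS `VERDICT-BORELGHOST-G30-g94.md`).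
AUTHORS OF THE BYTES: cruxidea-24801 generations 23 (`typecut`, §J.1) and 25 (`jacquet`, §L.1) for the nine helpers (token-identical in `realform` ∕ `borelghost` ∕ registry rev 10.1), generation 30 (`borelghost`) for §R. Declarations, statements and proofs below are token-identical to the source; the only edits are the namespace
(`…Cruxes.CartanOnePlaceDegreeLawAtThree.Borelghost` ↦ `…Theorems.CartanDoubleCoset`, shared with the `ClassRecordThreeCartanSupply*` lift modules), the imports ∕ `open`s ∕
section preamble each module needs, and one-line docstrings added where the source had none. Nothing is re-stated, weakened or re-proved.

CONTENT (finite group theory of `G = GL₂(𝔽_q)`, `q` prime; no `V`, no curve, no stub). Helpers: `P² = 1` (`weylP_mul_weylP`), `h(c)` ∕ `n(x)` upper-triangular, THE BRUHAT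
DECOMPOSITION `bruhat_of_ne`, `B` closed under products (`borel_mul`), `η₁₀ ≠ 0` (`eta10_ne_zero`), `G = T_η · B` (`exists_torus_mul_borel`), scalars are central (`scalar_comm`),
right translation in a multiplicatively closed `Finset` (`sum_mul_right_eq`). §R.1 split-torus bookkeeping: `exists_diag_unip_comm` (a diagonal `t`
normalises `N`), `upperUnip_inv`, `exists_unip_conj` (`t·n(y) ∼_N t` for non-central diagonal `t`), `coe_weyl_conj`. §R.2 (`section Trace`) the trace of an endomorphism with
range in a line `ℂw` (`trace_eq_of_range_le_line`) or a plane `ℂw ⊕ ℂu` (`trace_eq_of_range_le_pair`). §R.3 THE BOREL LINE: the torus sums of `ℂ[G]·w` (`w` a Borel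
EIGENvector) are multiples of `Σ_{T_η} t·w` (`torusSum_mem_span_of_eigen`), so a `T_η`-fixed vector of `ℂ[G]·w` lies on that line (`fixed_mem_line_of_borelEigen`).
Consumed by `…ClassRecordThreeCartanBorelGhostRBG` (§R.4 (RBG)). Import list = the referee's dry-run list (g94, 2026-08-31T11:36:16Z, rc 0).

HONEST: a `--supports stmt-BirchSwinnertonDyer-24801 --as helper` module of PROVED finite-group theory ∕ lattice bookkeeping; it closes NO registered stub and NO leaf of
24801 — the five stubs of registry `Lines/jacquet.lean` rev 10.1 ((JV) · (NCB) · (CV♭) · (DS) ∧ (JLᶜ) · (MO1ᴾ)) stand, the registry is untouched by this module, no count moves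
(1∕12 · 0∕12), nothing about NUM ∕ NUM♮ ∕ 24801 ∕ 32276 ∕ 19109 is proved for any curve; BSD is proved for no curve.
-/

set_option linter.dupNamespace false  -- `Summit.BirchSwinnertonDyer.BirchSwinnertonDyer.…` (summit = problem), as every file of this directory
set_option autoImplicit false

noncomputable section

open scoped Classical MatrixGroups
open Matrix

namespace Summit.BirchSwinnertonDyer.BirchSwinnertonDyer.Theorems.CartanDoubleCoset

open Summit.BirchSwinnertonDyer.BirchSwinnertonDyer.Theorems
open Summit.BirchSwinnertonDyer.BirchSwinnertonDyer.Theorems.CartanDegree (HasRatEigenvalue)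
open Summit.BirchSwinnertonDyer.BirchSwinnertonDyer.Theorems.CartanTorusCubeCut (torusSubgroup mem_torusSubgroup lin linGL
  linGL_coe lin_comm torusSubgroup_isCyclic card_torusSubgroup)
open Summit.BirchSwinnertonDyer.BirchSwinnertonDyer.Theorems.CartanCover.Charext.InertHecke (upperUnip lowerUnip coe_upperUnip
  coe_lowerUnip upperUnip_mul upperUnip_zero exists_unip_factorization)
open Summit.BirchSwinnertonDyer.BirchSwinnertonDyer.Theorems.CartanCover
open Summit.BirchSwinnertonDyer.BirchSwinnertonDyer.Theorems.CartanTorusCubeCut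

section BorelGhost

variable {q : ℕ} [Fact q.Prime]

/-! ### Borel bookkeeping helpers of §J.1 ∕ §L.1 (generations 23 ∕ 25), token-identical in `typecut` ∕ `jacquet` ∕ `realform` ∕ `borelghost` ∕ registry rev 10.1 -/

/-- `P² = 1`. -/
theorem weylP_mul_weylP : (weylP : GL (Fin 2) (ZMod q)) * weylP = 1 := by
  apply Units.ext
  rw [Units.val_mul, coe_weylP, Units.val_one]
  ext i j
  fin_cases i <;> fin_cases j <;> simp [Matrix.mul_apply, Fin.sum_univ_two]

/-- `h(c)` is upper-triangular. -/
theorem diagU_lower (c : (ZMod q)ˣ) : ((diagU c : GL (Fin 2) (ZMod q)) : Matrix (Fin 2) (Fin 2) (ZMod q)) 1 0 = 0 := by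
  rw [coe_diagU]; rfl

/-- `n(x)` is upper-triangular. -/
theorem upperUnip_lower (x : ZMod q) : ((upperUnip x : GL (Fin 2) (ZMod q)) : Matrix (Fin 2) (Fin 2) (ZMod q)) 1 0 = 0 := by
  rw [coe_upperUnip]; rfl

/-- THE BRUHAT DECOMPOSITION: an element with non-zero lower-left entry is `n(x) · P · b` with `b` upper-triangular. -/
theorem bruhat_of_ne (g : GL (Fin 2) (ZMod q)) (h : (g : Matrix (Fin 2) (Fin 2) (ZMod q)) 1 0 ≠ 0) :
    ∃ (x : ZMod q) (b : GL (Fin 2) (ZMod q)), (b : Matrix (Fin 2) (Fin 2) (ZMod q)) 1 0 = 0 ∧ g = upperUnip x * weylP * b := by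
  set x : ZMod q := (g : Matrix (Fin 2) (Fin 2) (ZMod q)) 0 0 / (g : Matrix (Fin 2) (Fin 2) (ZMod q)) 1 0 with hx
  refine ⟨x, weylP * upperUnip (-x) * g, ?_, ?_⟩
  · have hxg : x * (g : Matrix (Fin 2) (Fin 2) (ZMod q)) 1 0 = (g : Matrix (Fin 2) (Fin 2) (ZMod q)) 0 0 := div_mul_cancel₀ _ h
    rw [Units.val_mul, Units.val_mul, coe_weylP, coe_upperUnip]
    simp [Matrix.mul_apply, Fin.sum_univ_two]
    rw [← hxg]; ring
  · simp only [← mul_assoc]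
    rw [mul_assoc (upperUnip x) weylP weylP, weylP_mul_weylP, mul_one, upperUnip_mul, add_neg_cancel, upperUnip_zero, one_mul]


/-- `B` is closed under products. -/
theorem borel_mul {b b' : GL (Fin 2) (ZMod q)} (hb : (b : Matrix (Fin 2) (Fin 2) (ZMod q)) 1 0 = 0)
    (hb' : (b' : Matrix (Fin 2) (Fin 2) (ZMod q)) 1 0 = 0) :
    ((b * b' : GL (Fin 2) (ZMod q)) : Matrix (Fin 2) (Fin 2) (ZMod q)) 1 0 = 0 := by
  rw [Units.val_mul, Matrix.mul_apply, Fin.sum_univ_two, hb, hb', zero_mul, mul_zero, add_zero]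

/-- a matrix without rational eigenvalues has `η₁₀ ≠ 0`. -/
theorem eta10_ne_zero {eta : Matrix (Fin 2) (Fin 2) (ZMod q)} (hη : ¬ HasRatEigenvalue eta) : eta 1 0 ≠ 0 := by
  intro h
  apply hη
  refine ⟨eta 0 0, ?_⟩
  rw [Matrix.det_fin_two, Matrix.trace_fin_two, h]
  ring

/-- **`G = T_η · B`** (`T_η` is transitive on `P¹(𝔽_q)`): every `g` is `t * b` with `t` in the non-split torus of `η` and `b` upper-triangular
(a re-proof, inside this node's import cone, of the tree's `CartanTorusCubeCut.PS.exists_torus_mul_upper`). -/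
theorem exists_torus_mul_borel {eta : Matrix (Fin 2) (Fin 2) (ZMod q)} (hη : ¬ HasRatEigenvalue eta) (g : GL (Fin 2) (ZMod q)) :
    ∃ t ∈ nonsplitTorus eta, ∃ b : GL (Fin 2) (ZMod q), (b : Matrix (Fin 2) (Fin 2) (ZMod q)) 1 0 = 0 ∧ g = t * b := by
  suffices h : ∃ t ∈ nonsplitTorus eta, ((t⁻¹ * g : GL (Fin 2) (ZMod q)) : Matrix (Fin 2) (Fin 2) (ZMod q)) 1 0 = 0 by
    obtain ⟨t, ht, h10⟩ := h
    exact ⟨t, ht, t⁻¹ * g, h10, (mul_inv_cancel_left t g).symm⟩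
  by_cases hg : (g : Matrix (Fin 2) (Fin 2) (ZMod q)) 1 0 = 0
  · refine ⟨1, by simp [nonsplitTorus], ?_⟩
    rw [inv_one, one_mul]
    exact hg
  · have h10 : eta 1 0 ≠ 0 := eta10_ne_zero hη
    set s : ZMod q := (g : Matrix (Fin 2) (Fin 2) (ZMod q)) 1 0 * (eta 1 0)⁻¹ with hs
    set a : ZMod q := (g : Matrix (Fin 2) (Fin 2) (ZMod q)) 0 0 - s * eta 0 0 with ha
    have hs0 : s ≠ 0 := mul_ne_zero hg (inv_ne_zero h10)
    have hp : ((a, s) : ZMod q × ZMod q) ≠ 0 := fun h => hs0 (congrArg Prod.snd h)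
    refine ⟨linGL eta hη (a, s), ?_, ?_⟩
    · simp only [nonsplitTorus, Finset.mem_filter, Finset.mem_univ, true_and]
      rw [linGL_coe hη hp]
      exact lin_comm eta (a, s)
    · have key : (((linGL eta hη (a, s))⁻¹ * linGL eta hη (a, s) : GL (Fin 2) (ZMod q)) :
          Matrix (Fin 2) (Fin 2) (ZMod q)) 1 0 = 0 := by
        rw [inv_mul_cancel, Units.val_one, Matrix.one_apply_ne (by decide)]
      have h00' : (g : Matrix (Fin 2) (Fin 2) (ZMod q)) 0 0 =
          ((linGL eta hη (a, s) : GL (Fin 2) (ZMod q)) : Matrix (Fin 2) (Fin 2) (ZMod q)) 0 0 := by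
        rw [linGL_coe hη hp]
        simp [lin, ha]
      have h10' : (g : Matrix (Fin 2) (Fin 2) (ZMod q)) 1 0 =
          ((linGL eta hη (a, s) : GL (Fin 2) (ZMod q)) : Matrix (Fin 2) (Fin 2) (ZMod q)) 1 0 := by
        rw [linGL_coe hη hp]
        simp [lin, Matrix.one_apply_ne (by decide : (1 : Fin 2) ≠ 0), hs, inv_mul_cancel_right₀ h10]
      rw [Units.val_mul, Matrix.mul_apply, Fin.sum_univ_two] at key ⊢
      rw [h00', h10']
      exact key

/-- a diagonal matrix with equal diagonal entries (a SCALAR) is central. -/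
theorem scalar_comm {s : GL (Fin 2) (ZMod q)} (h01 : (s : Matrix (Fin 2) (Fin 2) (ZMod q)) 0 1 = 0)
    (h10 : (s : Matrix (Fin 2) (Fin 2) (ZMod q)) 1 0 = 0)
    (h00 : (s : Matrix (Fin 2) (Fin 2) (ZMod q)) 0 0 = (s : Matrix (Fin 2) (Fin 2) (ZMod q)) 1 1) (g : GL (Fin 2) (ZMod q)) :
    s * g = g * s := by
  apply Units.ext
  rw [Units.val_mul, Units.val_mul]
  ext i j
  fin_cases i <;> fin_cases j <;> simp [Matrix.mul_apply, Fin.sum_univ_two, h01, h10, h00] <;> ring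

/-- right translation inside a multiplicatively closed `Finset` (companion of the tree's `sum_mul_left_eq`). -/
theorem sum_mul_right_eq {Mo : Type*} [AddCommMonoid Mo] {S : Finset (GL (Fin 2) (ZMod q))}
    (hS : ∀ u ∈ S, ∀ s ∈ S, u * s ∈ S) {u : GL (Fin 2) (ZMod q)} (hu : u ∈ S) (f : GL (Fin 2) (ZMod q) → Mo) :
    ∑ s ∈ S, f (s * u) = ∑ s ∈ S, f s := by
  have h1 : S.map ⟨(· * u), mul_left_injective u⟩ = S := by
    apply Finset.eq_of_subset_of_card_le
    · intro x hx
      rw [Finset.mem_map] at hx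
      obtain ⟨s, hs, rfl⟩ := hx
      exact hS s hs u hu
    · rw [Finset.card_map]
  conv_rhs => rw [← h1]
  rw [Finset.sum_map]
  rfl

/-! ### §R.1 PROVED: split-torus bookkeeping — `2 ≠ 0`, `t·n(y)·t⁻¹ ∈ N`, `t·n(y) ∼_N t` for non-central diagonal `t`, the Weyl conjugate `P t P` -/

/- (lift note, tam3-p1 g43) the source's `two_ne_zero_of_ne_two (hq2 : q ≠ 2) : (2 : ZMod q) ≠ 0` (borelghost l.2215–2219) is NOT carried: the gate's dedup rule
   (`dedup.landed`) identifies it with the already-landed `Summit.BirchSwinnertonDyer.Rank1Residual.X6.PrintCert.two_ne_zero_zmod`; its single use site (§R.4 `rationalBorelGhost`,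
   module `…BorelGhostRBG`) takes `2 ≠ 0` from Mathlib (`Ring.two_ne_zero` + `ZMod.ringChar_zmod_n`) instead, adding no import edge. -/

/-- a diagonal `t` normalises `N`: `t · n(y) = n(c y) · t` for a unit `c` (`= t₀₀ ∕ t₁₁`) not depending on `y`. -/
theorem exists_diag_unip_comm (t : GL (Fin 2) (ZMod q)) (h01 : (t : Matrix (Fin 2) (Fin 2) (ZMod q)) 0 1 = 0)
    (h10 : (t : Matrix (Fin 2) (Fin 2) (ZMod q)) 1 0 = 0) :
    ∃ c : (ZMod q)ˣ, (((c : ZMod q) = 1 → (t : Matrix (Fin 2) (Fin 2) (ZMod q)) 0 0 = (t : Matrix (Fin 2) (Fin 2) (ZMod q)) 1 1)) ∧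
      ∀ y : ZMod q, t * upperUnip y = upperUnip ((c : ZMod q) * y) * t := by
  obtain ⟨c, hs01, hs10, hs00⟩ := diag_decomp t h01 h10
  have ht : t = diagU c * ((diagU c)⁻¹ * t) := (mul_inv_cancel_left _ _).symm
  refine ⟨c, fun hc1 => ?_, fun y => ?_⟩
  · have hc : c = 1 := Units.ext hc1
    rw [hc, diagU_one, inv_one, one_mul] at hs00
    exact hs00
  · calc t * upperUnip y = diagU c * (((diagU c)⁻¹ * t) * upperUnip y) := by
          conv_lhs => rw [ht]
          rw [mul_assoc]
      _ = diagU c * (upperUnip y * ((diagU c)⁻¹ * t)) := by rw [scalar_comm hs01 hs10 hs00]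
      _ = upperUnip ((c : ZMod q) * y) * (diagU c * ((diagU c)⁻¹ * t)) := by rw [← mul_assoc, diagU_mul_unip, mul_assoc]
      _ = upperUnip ((c : ZMod q) * y) * t := by rw [← ht]

/-- `n(x)⁻¹ = n(−x)`. -/
theorem upperUnip_inv (x : ZMod q) : (upperUnip x : GL (Fin 2) (ZMod q))⁻¹ = upperUnip (-x) :=
  inv_eq_of_mul_eq_one_right (by rw [upperUnip_mul, add_neg_cancel, upperUnip_zero])

/-- for a NON-CENTRAL diagonal `t`, every `t · n(y)` is conjugate to `t` by an element of `N`. -/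
theorem exists_unip_conj {t : GL (Fin 2) (ZMod q)} (h01 : (t : Matrix (Fin 2) (Fin 2) (ZMod q)) 0 1 = 0)
    (h10 : (t : Matrix (Fin 2) (Fin 2) (ZMod q)) 1 0 = 0)
    (hnc : (t : Matrix (Fin 2) (Fin 2) (ZMod q)) 0 0 ≠ (t : Matrix (Fin 2) (Fin 2) (ZMod q)) 1 1) (y : ZMod q) :
    ∃ x : ZMod q, t * upperUnip y = upperUnip x * t * (upperUnip x)⁻¹ := by
  obtain ⟨c, hc1, hc⟩ := exists_diag_unip_comm t h01 h10
  have h1c : (1 : ZMod q) - c ≠ 0 := fun h => hnc (hc1 (sub_eq_zero.mp h).symm)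
  refine ⟨(c : ZMod q) * y * ((1 : ZMod q) - c)⁻¹, ?_⟩
  rw [upperUnip_inv, mul_assoc, hc (-_), ← mul_assoc, upperUnip_mul, hc y]
  congr 2
  have e : (c : ZMod q) * y * ((1 : ZMod q) - c)⁻¹ + (c : ZMod q) * -((c : ZMod q) * y * ((1 : ZMod q) - c)⁻¹) =
      (c : ZMod q) * y * (((1 : ZMod q) - c)⁻¹ * ((1 : ZMod q) - c)) := by ring
  rw [e, inv_mul_cancel₀ h1c, mul_one]

/-- the matrix of the Weyl conjugate `P t P` of a diagonal `t`: the diagonal entries are swapped. -/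
theorem coe_weyl_conj (t : GL (Fin 2) (ZMod q)) :
    ((weylP * t * weylP : GL (Fin 2) (ZMod q)) : Matrix (Fin 2) (Fin 2) (ZMod q)) =
      !![(t : Matrix (Fin 2) (Fin 2) (ZMod q)) 1 1, (t : Matrix (Fin 2) (Fin 2) (ZMod q)) 1 0;
        (t : Matrix (Fin 2) (Fin 2) (ZMod q)) 0 1, (t : Matrix (Fin 2) (Fin 2) (ZMod q)) 0 0] := by
  rw [Units.val_mul, Units.val_mul, coe_weylP]
  ext i j
  simp only [Matrix.mul_apply, Fin.sum_univ_two]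
  fin_cases i <;> fin_cases j <;> simp

/-! ### §R.2 PROVED: the trace of an endomorphism with range in a line `ℂw` or a plane `ℂw ⊕ ℂu` -/

section Trace

variable {W : Type*} [AddCommGroup W] [Module ℂ W] [Module.Finite ℂ W]

/-- an endomorphism with range in the line `ℂ w` (`w ≠ 0`), acting on `w` by `a`, has trace `a`. -/
theorem trace_eq_of_range_le_line (φ : W →ₗ[ℂ] W) {w : W} (hw0 : w ≠ 0) {a : ℂ}
    (hrange : ∀ x : W, ∃ s : ℂ, φ x = s • w) (hw : φ w = a • w) : LinearMap.trace ℂ W φ = a := by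
  let ι : ℂ →ₗ[ℂ] W := LinearMap.toSpanSingleton ℂ W w
  have hιa : ∀ c : ℂ, ι c = c • w := fun c => rfl
  have hι : Function.Injective ι := fun c d h => smul_left_injective ℂ hw0 (by simpa only [hιa] using h)
  have hmem : ∀ x : W, φ x ∈ LinearMap.range ι := fun x => by
    obtain ⟨s, hs⟩ := hrange x
    exact ⟨s, by rw [hιa, hs]⟩
  let ψ : W →ₗ[ℂ] ℂ := (LinearEquiv.ofInjective ι hι).symm.toLinearMap ∘ₗ φ.codRestrict (LinearMap.range ι) hmem
  have hιψ : ι ∘ₗ ψ = φ := by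
    ext x
    simp only [ψ, LinearMap.coe_comp, LinearEquiv.coe_coe, Function.comp_apply]
    have h := LinearEquiv.ofInjective_symm_apply ι (h := hι) ⟨φ x, hmem x⟩
    exact h
  have hψι : ψ ∘ₗ ι = a • LinearMap.id := by
    apply LinearMap.ext_ring
    apply hι
    simp only [LinearMap.coe_comp, Function.comp_apply, LinearMap.smul_apply, LinearMap.id_apply, smul_eq_mul, mul_one]
    have h1 : ι (ψ (ι 1)) = φ (ι 1) := by rw [← hιψ]; rfl
    rw [h1, hιa 1, one_smul, hw, hιa]
  rw [← hιψ, LinearMap.trace_comp_comm', hψι, map_smul, LinearMap.trace_id, Module.finrank_self, Nat.cast_one, smul_eq_mul, mul_one]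

/-- an endomorphism with range in the plane `ℂ w ⊕ ℂ u` (`w, u` independent), acting on `w` by `a` and on `u` by `b`, has trace `a + b`. -/
theorem trace_eq_of_range_le_pair (φ : W →ₗ[ℂ] W) {w u : W} (hli : LinearIndependent ℂ ![w, u]) {a b : ℂ}
    (hrange : ∀ x : W, ∃ s r : ℂ, φ x = s • w + r • u) (hw : φ w = a • w) (hu : φ u = b • u) :
    LinearMap.trace ℂ W φ = a + b := by
  let ι : (Fin 2 → ℂ) →ₗ[ℂ] W := (LinearMap.proj 0 : (Fin 2 → ℂ) →ₗ[ℂ] ℂ).smulRight w + (LinearMap.proj 1 : (Fin 2 → ℂ) →ₗ[ℂ] ℂ).smulRight u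
  have hιa : ∀ c : Fin 2 → ℂ, ι c = c 0 • w + c 1 • u := fun c => rfl
  have hι : Function.Injective ι := by
    rw [injective_iff_map_eq_zero]
    intro c hc
    rw [hιa] at hc
    obtain ⟨h0, h1⟩ := (LinearIndependent.pair_iff.mp hli) (c 0) (c 1) hc
    funext i
    fin_cases i
    · exact h0
    · exact h1
  have hmem : ∀ x : W, φ x ∈ LinearMap.range ι := fun x => by
    obtain ⟨s, r, hs⟩ := hrange x
    exact ⟨![s, r], by rw [hιa, hs]; rfl⟩
  let ψ : W →ₗ[ℂ] (Fin 2 → ℂ) := (LinearEquiv.ofInjective ι hι).symm.toLinearMap ∘ₗ φ.codRestrict (LinearMap.range ι) hmem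
  have hιψ : ι ∘ₗ ψ = φ := by
    ext x
    simp only [ψ, LinearMap.coe_comp, LinearEquiv.coe_coe, Function.comp_apply]
    have h := LinearEquiv.ofInjective_symm_apply ι (h := hι) ⟨φ x, hmem x⟩
    exact h
  have hιψι : ∀ c, ι (ψ (ι c)) = φ (ι c) := fun c => by rw [← hιψ]; rfl
  have he0 : ψ (ι (Pi.single 0 1)) = a • Pi.single 0 1 := by
    apply hι
    rw [hιψι, map_smul, hιa]
    simp [hw]
  have he1 : ψ (ι (Pi.single 1 1)) = b • Pi.single 1 1 := by
    apply hι
    rw [hιψι, map_smul, hιa]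
    simp [hu]
  rw [← hιψ, LinearMap.trace_comp_comm', LinearMap.trace_eq_matrix_trace ℂ (Pi.basisFun ℂ (Fin 2)), Matrix.trace_fin_two,
    LinearMap.toMatrix_apply, LinearMap.toMatrix_apply, Pi.basisFun_apply, Pi.basisFun_apply, Pi.basisFun_repr, Pi.basisFun_repr,
    LinearMap.coe_comp, Function.comp_apply, Function.comp_apply, he0, he1]
  simp

end Trace

/-! ### §R.3 PROVED: THE BOREL LINE — the `T_η`-fixed vectors of `ℂ[G]·w`, `w` a Borel EIGENvector, lie on the line `ℂ·Σ_{T_η} t·w` (`G = T_η·B` + averaging) -/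

/-- the torus sums of `ℂ[G]·w` are multiples of `A = ∑_{T_η} t·w` (`w` a Borel EIGENvector; `G = T_η B`). -/
theorem torusSum_mem_span_of_eigen {W : Type*} [AddCommGroup W] [Module ℂ W] (ρ : Representation ℂ (GL (Fin 2) (ZMod q)) W)
    {eta : Matrix (Fin 2) (Fin 2) (ZMod q)} (hη : ¬ HasRatEigenvalue eta) {w : W} {lam : GL (Fin 2) (ZMod q) → ℂ}
    (hwb : ∀ b : GL (Fin 2) (ZMod q), (b : Matrix (Fin 2) (Fin 2) (ZMod q)) 1 0 = 0 → ρ b w = lam b • w)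
    {x : W} (hx : x ∈ Submodule.span ℂ (Set.range fun g : GL (Fin 2) (ZMod q) => ρ g w)) :
    ∃ c : ℂ, ∑ t ∈ nonsplitTorus eta, ρ t x = c • ∑ t ∈ nonsplitTorus eta, ρ t w := by
  induction hx using Submodule.span_induction with
  | mem x hx =>
    obtain ⟨g, rfl⟩ := hx
    obtain ⟨t₀, ht₀, b₀, hb₀, rfl⟩ := exists_torus_mul_borel hη g
    refine ⟨lam b₀, ?_⟩
    have hTT : ∀ u ∈ nonsplitTorus eta, ∀ s ∈ nonsplitTorus eta, u * s ∈ nonsplitTorus eta :=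
      fun u hu s hs => nonsplitTorus_mul_mem hu hs
    calc ∑ t ∈ nonsplitTorus eta, ρ t (ρ (t₀ * b₀) w)
        = ∑ t ∈ nonsplitTorus eta, lam b₀ • ρ (t * t₀) w := by
          refine Finset.sum_congr rfl fun t _ => ?_
          rw [map_mul, Module.End.mul_apply, hwb b₀ hb₀, map_smul, map_smul, map_mul, Module.End.mul_apply]
      _ = lam b₀ • ∑ t ∈ nonsplitTorus eta, ρ t w := by
          rw [← Finset.smul_sum, sum_mul_right_eq hTT ht₀ fun t => ρ t w]
  | zero => exact ⟨0, by simp⟩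
  | add x y _ _ hx hy =>
    obtain ⟨c, hc⟩ := hx
    obtain ⟨d, hd⟩ := hy
    exact ⟨c + d, by simp only [map_add, Finset.sum_add_distrib, hc, hd, add_smul]⟩
  | smul a x _ hx =>
    obtain ⟨c, hc⟩ := hx
    exact ⟨a * c, by simp only [map_smul, ← Finset.smul_sum, hc, smul_smul]⟩

/-- **THE BOREL LINE.** A `T_η`-FIXED vector of `ℂ[G]·w` (`w` a Borel eigenvector) is a multiple of the torus sum `∑_{T_η} t·w` (averaging over `T_η`). -/
theorem fixed_mem_line_of_borelEigen {W : Type*} [AddCommGroup W] [Module ℂ W] (ρ : Representation ℂ (GL (Fin 2) (ZMod q)) W)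
    {eta : Matrix (Fin 2) (Fin 2) (ZMod q)} (hη : ¬ HasRatEigenvalue eta) {w : W} {lam : GL (Fin 2) (ZMod q) → ℂ}
    (hwb : ∀ b : GL (Fin 2) (ZMod q), (b : Matrix (Fin 2) (Fin 2) (ZMod q)) 1 0 = 0 → ρ b w = lam b • w)
    {v : W} (hv : v ∈ Submodule.span ℂ (Set.range fun g : GL (Fin 2) (ZMod q) => ρ g w))
    (hfix : ∀ t ∈ torusSubgroup eta, ρ t v = v) :
    ∃ c : ℂ, v = c • ∑ t ∈ nonsplitTorus eta, ρ t w := by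
  obtain ⟨c, hc⟩ := torusSum_mem_span_of_eigen ρ hη hwb hv
  have hTv : ∑ t ∈ nonsplitTorus eta, ρ t v = ((nonsplitTorus eta).card : ℂ) • v := by
    rw [Finset.sum_congr rfl fun t ht => hfix t (mem_nonsplitTorus_iff.mp ht), Finset.sum_const, Nat.cast_smul_eq_nsmul]
  have hT : ((nonsplitTorus eta).card : ℂ) ≠ 0 :=
    Nat.cast_ne_zero.mpr (Finset.card_ne_zero.mpr ⟨1, by simp [nonsplitTorus]⟩)
  refine ⟨((nonsplitTorus eta).card : ℂ)⁻¹ * c, ?_⟩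
  rw [mul_smul, ← hc, hTv, smul_smul, inv_mul_cancel₀ hT, one_smul]

end BorelGhost

end Summit.BirchSwinnertonDyer.BirchSwinnertonDyer.Theorems.CartanDoubleCoset

end
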